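import Summits.BirchSwinnertonDyer.BirchSwinnertonDyer.Theorems.SchneiderFreeAdditiveX3KYReadHyps
import Literature.NumberTheory.EllipticCurves.KellerYin2024.PotentiallyGoodOrdinaryIwasawaTheoryBranch
import HarnessLib
import HarnessLib.Audit.Tags

/-!
# Route `SchneiderFreeAdditiveX3` (K1 door), crux `GordTwoBranchIMC` (stmt-BirchSwinnertonDyer-19177):
# SHORT NAMES for the BRANCH-CURRENCY inputs of the line «KY-read» — `KYReadCHValue` (the value half
# of `stub_CH`, at a `μ = 0` branch frame of the good partner) and `GenusConductorOne` (the one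
# elementary hypothesis of the Castella–Hsieh existence fact not yet a tree theorem)

Cell `bsd-schneider-ideate` (HOME `run/shared/lean/pub/bsd-schneider-ideate/`), seat `door-c3` gen 9.
PARTITION: board row B6 ∩ X3 ∩ sst-twist, r = 1, (G-ord, `e = 2`) half (2 560 of 7 101 pairs) of
`Rank1Residual.partition`; types-the-object-of the inputs of crux r3's record after the branch-currency
re-keying of `stub_CH` (door-c3 gen 8 FINDING `door-c3-g8-branch-currency.md`, gen 9 files
`Literature/…/KellerYin2024/PotentiallyGoodOrdinaryIwasawaTheoryBranch.lean` p492331 and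
`Theorems/SchneiderFreeAdditiveX3GordTwoBranchIMCDivOfKYBranch.lean`); closes nothing (BSD is not
advanced; the crux stays OPEN behind the Keller–Yin PREPRINT claims).

Sequel of `…KYReadHyps.lean` (door-c3 gen 8: `KYReadGoodMember`, `KYReadCH`, `KYReadSliver`). The
registered `stub_CH = KYReadCH` bundled THREE things at the conjugate prime `𝔭′`: (a) a Castella-shape
frame `IsBDPLFunction ι′ 𝔭′ κ γ Dt.f …` for the ADDITIVE curve's newform — neither printed nor derivable
in the tree; (b) `μ = 0` for it (Keller–Yin); (c) Castella–Hsieh's conductor-`p` value formula for it.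
In BRANCH CURRENCY (the printed object: Castella–Hsieh's measure for the GOOD partner's newform
`Dt′.f` on the `χ_ε`-branch, `χ_ε = KellerYin2024.genusHeckeCharacter K p`, tree predicate
`IsBranchBDPLFunction`): (a) is the PUBLISHED fact `castellaHsieh2018_exists_isBranchBDPLFunction`
(Math. Ann. 370 (2018) Def. 3.7 + Prop. 3.8, p489390) modulo its three branch-character hypotheses —
`χ_ε² = 1` and unramified-off-`p` are Literature THEOREMS (`genusHeckeCharacter_sq`,
`genusHeckeCharacter_isUnramifiedAt`), the conductor exponent exactly `1` above `p` is
**`GenusConductorOne`** below (local class field theory for `ψ_ε = HeckeCharacter.ofDirichlet ε`: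
elementary, owed — the typer lane was asked, P2 g13 STATUS 2026-08-27 03:08Z); (b) disappears — the
branch claim `KellerYin2024.thm351_charIdeal_eq_branch_OPEN` turns ANY frame into a `μ = 0` frame with
the same periods (`exists_frame_firstUnitCoeff_charIdeal_eq_of_branch_OPEN`); (c) becomes
**`KYReadCHValue`** below: Castella–Hsieh Lemma 5.4 + Thm. 5.7 (PUBLISHED, cite item wi-73260, blocked
on the definition item `defn-padicLogPointFiniteExt` for its verbatim form over `K[p]_𝔓`) READ AT A
`μ = 0` BRANCH FRAME in the door's DESCENDED shape (logarithm of the K-rational descent `Q ∈ W(K)` of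
the genus-twisted Heegner point, over `K_{𝔭′} = ℚ_p`; door-c3 gen 8 addendum (b)). With these names
the H-record of crux r3 reads `PrintedFacts → ControlFacts → RebasedFactsG → thm351_…_OPEN →
thm351_charIdeal_eq_branch_OPEN → castellaHsieh2018_exists_isBranchBDPLFunction → GenusConductorOne →
KYReadCHValue → KYReadSliver → GordTwoBranchIMC` (proof term in the sibling
`…GordTwoBranchIMCOfKYBranch.lean`).

HONEST FRAMING: two predicates WITH BODIES, tagged `@[conjecture]` like the route's sockets
(obligation nodes, nothing asserted); `GenusConductorOne` is provable (no `sorry` road-block, just not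
done); `KYReadCHValue` is a PUBLISHED formula in a derived (descended) shape plus Keller–Yin's frame
classification — a hypothesis of the road, not a fact of the tree. Theses-free.

References: Castella–Hsieh, Math. Ann. 370 (2018) Def. 3.7, Prop. 3.8, Lemma 5.4, Thm. 5.7
(arXiv:1505.08165 pp. 10–11, 17–19); Keller–Yin arXiv:2410.23241 §3.1 Prop. 3.1.3, §3.4, Thm. 3.5.1;
Neukirch ANT VII (6.9)–(6.10) (conductor of `ψ_ε`); Tate's thesis §2.3.
-/

noncomputable section

open scoped Classical ComplexConjugate

open WeierstrassCurve NumberField IsDedekindDomain Field PowerSeries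
  Literature.NumberTheory.EllipticCurves
  Literature.NumberTheory.EllipticCurves.ModularForms
  Literature.NumberTheory.EllipticCurves.GreenbergSelmer
  Literature.NumberTheory.EllipticCurves.Rank1Residual
  Literature.NumberTheory.EllipticCurves.KellerYin2024
  Literature.NumberTheory.GaloisRepresentations
  Summit.BirchSwinnertonDyer.Rank1Residual
  Summit.BirchSwinnertonDyer.Rank1Residual.X11b
  Summit.BirchSwinnertonDyer.Rank1Residual.X11b.AcSelmer
  Summit.BirchSwinnertonDyer.Rank1Residual.X11b.Halves

-- D-0017 layout: summit = sub-problem, so `Summit.BirchSwinnertonDyer.BirchSwinnertonDyer.…` is the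
-- mandated namespace (same option as the route's sockets files).
set_option linter.dupNamespace false
set_option autoImplicit false

namespace Summit.BirchSwinnertonDyer.BirchSwinnertonDyer.Theorems.SchneiderFree.KYRead

/-! ## §1 The conductor of the genus character above `p` -/

/-- **`GenusConductorOne`** — the third branch-character hypothesis of
`castellaHsieh2018_exists_isBranchBDPLFunction` for `χ_ε = genusHeckeCharacter K p`: over an imaginary
quadratic `K` in which the odd prime `p` SPLITS, the local component of `χ_ε = ψ_ε ∘ N_{K/ℚ}` at each
prime `𝔮 ∣ p` has conductor exponent EXACTLY `1` (`K_𝔮 = ℚ_p`, `χ_{ε,𝔮} = ε_p` on `ℤ_p^×`: the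
Legendre symbol, trivial on `1 + pℤ_p`, non-trivial). Elementary local class field theory for
`ψ_ε = HeckeCharacter.ofDirichlet ε` (Neukirch VII (6.9)–(6.10)); NOT yet a tree theorem (the ramified
local component of `ofDirichlet` has no lemma), hence recorded as an input. A predicate; nothing
asserted. [cite: NeukirchANT1999, Ch. VII Prop. (6.9)–(6.10) (conductor of the Hecke character of a Dirichlet character)]
[cite: CastellaHsieh2018, Prop. 3.8 (the hypothesis "χ of conductor p")] -/
@[conjecture]
def GenusConductorOne : Prop :=
  ∀ (K : Type) [Field K] [NumberField K] [IsGalois ℚ K] (p : ℕ) [Fact p.Prime], p ≠ 2 →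
    IsImaginaryQuadratic K → ((Ideal.span {(p : ℤ)}).primesOver (𝓞 K)).ncard = 2 →
    ∀ 𝔮 : HeightOneSpectrum (𝓞 K), ((p : ℕ) : 𝓞 K) ∈ 𝔮.asIdeal →
      (genusHeckeCharacter K p).HasConductorExponentAt 𝔮 1

/-! ## §2 The value half of `stub_CH`, at a `μ = 0` branch frame of the good partner -/

/-- **`KYReadCHValue`** — the VALUE half of the Castella–Hsieh input, in branch currency. Same data
as `KYReadCH` (the presented door curve `W = C₂ • ((D • W′) ⊗ χ_{p*})`, `W′` good ordinary at `p`, a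
socket datum with `d_K ≠ −3`, the socket's degree-one `𝔭`, a parametrisation datum `Dt′` of `W′`,
the conductor-`p` data over `K[p]`, a conductor-`p` Heegner point `y` of `W′`, a square root `θ` of
`p*` with its sign cocycle `s`, the descent `Q ∈ W(K)` of the genus-twisted point; the conjugate
degree-one prime `𝔭′ ≠ 𝔭` and an embedding datum `ι′` inducing it), PLUS `[IsGalois ℚ K]` for the norm;
CONCLUSION: for EVERY branch frame `(e ≠ 0, Ω_K ≠ 0, Ω_p ∈ R₀^×, L)` of `(Dt′.f, χ_ε)` at `𝔭′`
(`IsBranchBDPLFunction ι′ 𝔭′ κ γ Dt′.f (genusHeckeCharacter K p) e Ω_K Ω_p L`) with `μ(L) = 0`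
(`¬ p ∣ L`), there is `u ∈ R₀` with `L(𝟙) = u · (log_{ω_W}(Q)/c′)²`, the logarithm through
`embAt K p 𝔭′`. IN PRINT: Castella–Hsieh Lemma 5.4 + Thm. 5.7 give `𝓛_ε(𝟙) = u_CH·(log z)²` for THEIR
frame, with `z = Σ_σ χ_ε(σ) y^σ` and an explicit `p`-integral `u_CH`; the twisting isomorphism carries
`z` to the `K`-rational `Q` and `(log z)²` to `(p*)^{∓1}(log_{ω_W} Q)²`; every `μ = 0` branch frame is
`A·(1+T)^s·𝓛_ε` with `A ∈ R₀^×` given `μ(𝓛_ε) = 0` (Keller–Yin Thm. 3.5.1) — so the statement follows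
from print for every such frame. A predicate; nothing asserted; the remaining UNTYPED input of crux
r3's (G-ord, `e = 2`) road (cite item wi-73260).
[cite: CastellaHsieh2018, Lemma 5.4 and Thm. 5.7 (arXiv:1505.08165 pp. 17–19)]
[cite: KellerYin2024b, §3.4 and Thm. 3.5.1 (arXiv:2410.23241 pp. 19–20) (preprint: μ(𝓛_ε) = 0)] -/
@[conjecture]
def KYReadCHValue : Prop :=
  ∀ (p : ℕ) [Fact p.Prime] (W' : WeierstrassCurve ℚ) [W'.IsElliptic] [W'.IsGloballyMinimal]
    [NeZero (W'.conductorNorm ℤ)] (D C₂ : VariableChange ℚ) [(D • W').IsCharNeTwoNF]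
    [(C₂ • (D • W').quadraticTwist ((-1 : ℚ) ^ (p / 2) * p)).IsElliptic]
    [(C₂ • (D • W').quadraticTwist ((-1 : ℚ) ^ (p / 2) * p)).IsGloballyMinimal]
    (N : ℕ) [NeZero N] (K : Type) [Field K] [NumberField K] [IsGalois ℚ K]
    (Dt : ModularParametrizationData (C₂ • (D • W').quadraticTwist ((-1 : ℚ) ^ (p / 2) * p)) N)
    (H : HeegnerDatum N (NumberField.discr K)) (ι : K →+* ℂ)
    (P : ((C₂ • (D • W').quadraticTwist ((-1 : ℚ) ^ (p / 2) * p)).baseChange K).toAffine.Point),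
    (C₂ • (D • W').quadraticTwist ((-1 : ℚ) ^ (p / 2) * p)).analyticRank = 1 →
    Additive.N10.Locus (C₂ • (D • W').quadraticTwist ((-1 : ℚ) ^ (p / 2) * p)) p →
    (C₂ • (D • W').quadraticTwist ((-1 : ℚ) ^ (p / 2) * p)).conductorNorm ℤ = N →
    IsImaginaryQuadratic K → Odd (NumberField.discr K) → ¬ p ∣ Units.torsionOrder K →
    SatisfiesHeegnerHypothesis N K →
    ((C₂ • (D • W').quadraticTwist ((-1 : ℚ) ^ (p / 2) * p)).quadraticTwist
      (NumberField.discr K : ℚ)).entireLFunction 1 ≠ 0 →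
    WeierstrassCurve.Affine.Point.map ι.toRatAlgHom P = heegnerPointComplex Dt H →
    ¬ IsOfFinAddOrder P → p ≠ 2 → GoodOrd W' p → NumberField.discr K ≠ -3 →
    ∀ (κ : ZpExtension K p), κ.IsAnticyclotomic →
    ∀ (γ : Field.absoluteGaloisGroup K) [Fact (κ.IsTopGenerator γ)]
      (𝔭 : HeightOneSpectrum (𝓞 K)) (h𝔭 : ((p : ℕ) : 𝓞 K) ∈ 𝔭.asIdeal)
      (he : 𝔭.asIdeal.ramificationIdx (𝓞 ℚ) = 1) (hf : 𝔭.asIdeal.inertiaDeg (𝓞 ℚ) = 1),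
    ∀ [NumberField (ringClassField K ι p)]
      (Dt' : ModularParametrizationData W' (W'.conductorNorm ℤ)),
    ∀ (𝔭' : HeightOneSpectrum (𝓞 K)) (h𝔭' : ((p : ℕ) : 𝓞 K) ∈ 𝔭'.asIdeal)
      (he' : 𝔭'.asIdeal.ramificationIdx (𝓞 ℚ) = 1) (hf' : 𝔭'.asIdeal.inertiaDeg (𝓞 ℚ) = 1),
    𝔭 ≠ 𝔭' → ∀ (ι' : PadicAlgCl p ≃+* ℂ), BranchInducesPrime p ι' 𝔭' →
    ∀ (e : ℂ) (ΩK : ℂ) (Ωp : (unrIntegers p)ˣ) (L : UnrSeries p), e ≠ 0 → ΩK ≠ 0 →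
      IsBranchBDPLFunction ι' 𝔭' κ γ Dt'.f (KellerYin2024.genusHeckeCharacter K p) e ΩK
        ((Ωp : unrIntegers p) : ℂ_[p]) L →
      ¬ C (p : unrIntegers p) ∣ L →
    ∃ u : unrIntegers p,
      ∀ (y : (W'.baseChange (ringClassField K ι p : Type)).toAffine.Point),
        WeierstrassCurve.Affine.Point.map (ringClassField K ι p).subtype.toRatAlgHom y =
          heegnerPointComplexOfConductor Dt' (NumberField.discr K) H.β p →
        ∀ (θ : ringClassField K ι p)
          (hθ2 : θ ^ 2 = algebraMap ℚ (ringClassField K ι p) ((-1 : ℚ) ^ (p / 2) * p))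
          (hθ : θ ≠ 0) (s : ringClassGal ι p → ℤˣ),
        (∀ σ : ringClassGal ι p, σ.1 θ = ((s σ : ℤ) : ringClassField K ι p) * θ) →
        ∀ Q : ((C₂ • (D • W').quadraticTwist ((-1 : ℚ) ^ (p / 2) * p)).baseChange K).toAffine.Point,
        Affine.Point.map (algebraMap K (ringClassField K ι p)).toRatAlgHom Q =
          VariableChange.pointEquivBaseChange ((D • W').quadraticTwist ((-1 : ℚ) ^ (p / 2) * p)) C₂
            (ringClassField K ι p)
            ((VariableChange.pointEquiv (((D • W').quadraticTwist
                ((-1 : ℚ) ^ (p / 2) * p)).baseChange (ringClassField K ι p : Type))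
                (untwistAt hθ)).symm
              ((Affine.Point.congrEquiv (untwistAt_smul_eq (D • W') hθ2 hθ)).symm
                (VariableChange.pointEquivBaseChange W' D (ringClassField K ι p)
                  (∑ τ : ringClassGal ι p,
                    (s τ : ℤ) • pointGalHom W' (ringClassField K ι p : Type) τ.1 y)))) →
        L.HasValueAt 0 (((u : unrIntegers p) : ℂ_[p]) *
          (algebraMap ℚ_[p] ℂ_[p] (logOmega (C₂ • (D • W').quadraticTwist ((-1 : ℚ) ^ (p / 2) * p))
            p (embAt K p 𝔭' h𝔭' he' hf') Q / (Dt'.c : ℚ_[p]))) ^ 2)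

end Summit.BirchSwinnertonDyer.BirchSwinnertonDyer.Theorems.SchneiderFree.KYRead

end
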